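import Mathlib.Analysis.SpecialFunctions.SmoothTransition
import Mathlib.Analysis.SpecialFunctions.Sqrt
import Mathlib.Analysis.Calculus.Deriv.Inv
import Literature.Geometry.Lorentzian.KerrSchildCoord
import Literature.Geometry.Lorentzian.MinkowskiRadialMultiplier

/-!
# Crux `AdiabaticMultiKerrILED` (line `Sketch`) — divergence of the Hardy current of the
# tails-cut Schwarzschild zone

Helper file for the crux `stmt-FinalStateConjecture-14310`
(`Summit.FinalStateConjecture.FinalStateConjecture.Theses.ClusterCompleteness.AdiabaticMultiKerrILED`),
line `Sketch`, stub `sum_fderiv_hardyCurrent_tailsCut` (lead c7, wave 4, Morawetz bricks).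

In the rest frame the zero-spin tails-cut zone is the static metric `g = −f dT² + dr²/f + r² dΩ²`,
`f = 1 − μ`, `μ(x) = χ(r) · 2M/r`, `χ(r) = Real.smoothTransition (2 − r/(8M))`, written in
ingoing Kerr–Schild Cartesian coordinates (`r = Kerr.radius 0 x = ‖x⃗‖`,
`Kerr.scalarH M 0 x = M/r`). The near-horizon negativity of the zeroth-order coefficient of the
degenerate Morawetz estimate is absorbed by the **Hardy current**
`J_H^μ = ½ y(r) ψ² (∂_{r*})^μ`, `(∂_{r*})⁰ = μ`, `(∂_{r*})ⁱ = (1 − μ) xⁱ/r`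
(Dafermos–Rodnianski arXiv:0811.0354, §4.1.1). This file proves its divergence identity

`∑_μ ∂_μ J_H^μ = y(r) ψ · (f (x⃗·∇ψ)/r + μ ∂₀ψ) + ½ ψ² · r⁻² (r² f y)′(r)`

(`sum_fderiv_hardyCurrent_tailsCut`): the time component contributes `y μ ψ ∂₀ψ` (`∂₀ r = 0`),
the space components `∂ᵢ[½ y ψ² f xⁱ/r]` contribute `y f ψ (x⃗·∇ψ)/r + ½ ψ² div(y f x⃗/r)` with
`div(h(r) x⃗/r) = h′ + 2h/r = r⁻² (r² h)′`. The calculus bricks (`∂_μ r = (0, x⃗/r)` at `a = 0`,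
the chain rule through `r`, the flat divergence `∑ᵢ ∂ᵢ (g(r) xⁱ) = g′ r + 3 g`) are proved for an
arbitrary profile `m` differentiable at `r(x)` (`hardy_sum_fderiv_radialCurrent`) and then
specialised to the tails-cut profile. [folklore]
-/

noncomputable section

-- the doubled `FinalStateConjecture.FinalStateConjecture` path component trips dupNamespace
set_option linter.dupNamespace false

open scoped BigOperators
open Literature.Geometry.Lorentzian

namespace Summit.FinalStateConjecture.FinalStateConjecture.Theorems

/-! ### Radius calculus at `a = 0` -/

/-- For `a = 0` the Kerr–Schild scalar is `H = M/r` on all of `E4` (both sides vanish on the time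
axis `r = 0`, where Lean's division by zero returns `0`). Visser arXiv:0706.0622, (33). [folklore] -/
theorem hardy_scalarH_zero (M : ℝ) (z : E4) : Kerr.scalarH M 0 z = M / Kerr.radius 0 z := by
  unfold Kerr.scalarH
  by_cases h : Kerr.radius 0 z = 0
  · simp [h]
  · field_simp
    ring

/-- The radial covector `x¹ dx¹ + x² dx² + x³ dx³` annihilates `∂₀`. [folklore] -/
theorem hardy_radCovector_basisVector_zero (x : E4) :
    ((x 1) • E4.dx 1 + (x 2) • E4.dx 2 + (x 3) • E4.dx 3) (E4.basisVector 0) = 0 := by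
  simp

/-- **The gradient of the area radius at `a = 0`**: `dr = r⁻¹ (x¹ dx¹ + x² dx² + x³ dx³)` off the
time axis (`r = ‖x⃗‖ = √(x₁² + x₂² + x₃²)`). [folklore] -/
theorem hardy_hasFDerivAt_radius_zero {x : E4} {r : ℝ} (hr : Kerr.radius 0 x = r) (h0 : 0 < r) :
    HasFDerivAt (Kerr.radius 0)
      (r⁻¹ • ((x 1) • E4.dx 1 + (x 2) • E4.dx 2 + (x 3) • E4.dx 3)) x := by
  have hfun : Kerr.radius 0 = fun z ↦ Real.sqrt (E4.spatialNorm z ^ 2) := by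
    funext z
    rw [Kerr.radius_zero_left, Real.sqrt_sq (E4.spatialNorm_nonneg z)]
  have hxr : E4.spatialNorm x = r := by rw [← Kerr.radius_zero_left, hr]
  have hne : E4.spatialNorm x ^ 2 ≠ 0 := by
    rw [hxr]
    positivity
  have h := (Real.hasDerivAt_sqrt hne).comp_hasFDerivAt x (KerrSchild.hasFDerivAt_spatialNormSq x)
  rw [hfun]
  refine h.congr_fderiv ?_
  rw [Real.sqrt_sq (E4.spatialNorm_nonneg x), hxr]
  ext v
  simp only [smul_apply, add_apply, smul_eq_mul]
  field_simp

/-- **Chain rule through the area radius**: if `g` has derivative `g'` at `r = r(x) > 0`, then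
`d(g ∘ r)_x = g' r⁻¹ (x¹ dx¹ + x² dx² + x³ dx³)`. [folklore] -/
theorem hardy_hasFDerivAt_comp_radius {g : ℝ → ℝ} {g' r : ℝ} {x : E4}
    (hr : Kerr.radius 0 x = r) (h0 : 0 < r) (hg : HasDerivAt g g' r) :
    HasFDerivAt (fun z ↦ g (Kerr.radius 0 z))
      ((g' * r⁻¹) • ((x 1) • E4.dx 1 + (x 2) • E4.dx 2 + (x 3) • E4.dx 3)) x := by
  have hg' : HasDerivAt g g' (Kerr.radius 0 x) := by rwa [hr]
  have h := hg'.comp_hasFDerivAt x (hardy_hasFDerivAt_radius_zero hr h0)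
  rw [smul_smul] at h
  exact h

/-- `∂₀ (g ∘ r) = 0`: radial functions are stationary. [folklore] -/
theorem hardy_fderiv_comp_radius_basisVector_zero {g : ℝ → ℝ} {g' r : ℝ} {x : E4}
    (hr : Kerr.radius 0 x = r) (h0 : 0 < r) (hg : HasDerivAt g g' r) :
    fderiv ℝ (fun z ↦ g (Kerr.radius 0 z)) x (E4.basisVector 0) = 0 := by
  rw [(hardy_hasFDerivAt_comp_radius hr h0 hg).fderiv, smul_apply,
    hardy_radCovector_basisVector_zero, smul_zero]

/-- **Flat divergence of a radial vector field**: `∑ᵢ ∂ᵢ (g(r) xⁱ) = g′(r) r + 3 g(r)` at a point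
with `r = r(x) > 0` (`∂ᵢ r = xⁱ/r`, `∑ᵢ (xⁱ)² = r²`). [folklore] -/
theorem hardy_sum_fderiv_comp_radius_mul_coord {g : ℝ → ℝ} {g' r : ℝ} {x : E4}
    (hr : Kerr.radius 0 x = r) (h0 : 0 < r) (hg : HasDerivAt g g' r) :
    ∑ i : Fin 3, fderiv ℝ (fun z ↦ g (Kerr.radius 0 z) * z i.succ) x (E4.basisVector i.succ) =
      g' * r + 3 * g r := by
  have hcomp : ∀ i : Fin 3,
      fderiv ℝ (fun z ↦ g (Kerr.radius 0 z) * z i.succ) x (E4.basisVector i.succ) =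
        g' * r⁻¹ * x i.succ * x i.succ + g r := by
    intro i
    rw [((hardy_hasFDerivAt_comp_radius hr h0 hg).fun_mul
      (KerrSchild.hasFDerivAt_coord i.succ x)).fderiv]
    fin_cases i <;> simp [hr] <;> ring
  have hsq : x 1 ^ 2 + x 2 ^ 2 + x 3 ^ 2 = r ^ 2 := by
    rw [← E4.spatialNorm_sq, ← Kerr.radius_zero_left, hr]
  have hu : r⁻¹ * (x 1 ^ 2 + x 2 ^ 2 + x 3 ^ 2) = r := by
    rw [hsq]
    field_simp
  simp only [hcomp]
  simp only [Fin.sum_univ_three, Fin.succ_zero_eq_one, Fin.succ_one_eq_two,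
    Kerr.fin_succ_two_eq_three]
  linear_combination g' * hu

/-! ### The two kinds of components of the Hardy current -/

/-- Time component: `∂₀ [ψ² K(r)] = 2 ψ ∂₀ψ K(r)` (`∂₀ r = 0`). [folklore] -/
theorem hardy_fderiv_sq_mul_comp_radius_zero {K : ℝ → ℝ} {K' r : ℝ} {ψ : E4 → ℝ} {x : E4}
    (hr : Kerr.radius 0 x = r) (h0 : 0 < r) (hK : HasDerivAt K K' r)
    (hψ : DifferentiableAt ℝ ψ x) :
    fderiv ℝ (fun z ↦ ψ z ^ 2 * K (Kerr.radius 0 z)) x (E4.basisVector 0) =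
      2 * ψ x * fderiv ℝ ψ x (E4.basisVector 0) * K r := by
  have hKd : DifferentiableAt ℝ (fun z ↦ K (Kerr.radius 0 z)) x :=
    (hardy_hasFDerivAt_comp_radius hr h0 hK).differentiableAt
  rw [fderiv_fun_mul (hψ.fun_pow 2) hKd, (hψ.hasFDerivAt.pow 2).fderiv]
  simp only [add_apply, smul_apply, smul_eq_mul,
    hardy_fderiv_comp_radius_basisVector_zero hr h0 hK, hr, nsmul_eq_mul, Nat.cast_ofNat,
    Nat.add_one_sub_one, pow_one]
  ring

/-- Space components: `∂ᵢ [ψ² (H(r) xⁱ)] = 2 ψ ∂ᵢψ H(r) xⁱ + ψ² ∂ᵢ (H(r) xⁱ)`. [folklore] -/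
theorem hardy_fderiv_sq_mul_comp_radius_mul_coord {H : ℝ → ℝ} {H' r : ℝ} {ψ : E4 → ℝ}
    {x : E4} (hr : Kerr.radius 0 x = r) (h0 : 0 < r) (hH : HasDerivAt H H' r)
    (hψ : DifferentiableAt ℝ ψ x) (i : Fin 3) :
    fderiv ℝ (fun z ↦ ψ z ^ 2 * (H (Kerr.radius 0 z) * z i.succ)) x (E4.basisVector i.succ) =
      2 * ψ x * fderiv ℝ ψ x (E4.basisVector i.succ) * (H r * x i.succ) +
        ψ x ^ 2 * fderiv ℝ (fun z ↦ H (Kerr.radius 0 z) * z i.succ) x (E4.basisVector i.succ) := by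
  have hGd : DifferentiableAt ℝ (fun z ↦ H (Kerr.radius 0 z) * z i.succ) x :=
    (hardy_hasFDerivAt_comp_radius hr h0 hH).differentiableAt.fun_mul
      (KerrSchild.hasFDerivAt_coord i.succ x).differentiableAt
  rw [fderiv_fun_mul (hψ.fun_pow 2) hGd, (hψ.hasFDerivAt.pow 2).fderiv]
  simp only [add_apply, smul_apply, smul_eq_mul, hr,
    nsmul_eq_mul, Nat.cast_ofNat, Nat.add_one_sub_one, pow_one]
  ring

/-! ### The divergence identity for an abstract radial profile -/

/-- **Divergence of the Hardy current, abstract profile.** For `m`, `y` differentiable at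
`r = r(x) > 0` and `ψ` differentiable at `x`,
`∂₀[½ y(r) ψ² m(r)] + ∑ᵢ ∂ᵢ[½ y(r) ψ² (1 − m(r)) xⁱ/r]
  = y ψ ((1 − m) (x⃗·∇ψ)/r + m ∂₀ψ) + ½ ψ² r⁻² (r² (1 − m) y)′(r)`.
Dafermos–Rodnianski arXiv:0811.0354, §4.1.1 (Hardy/zeroth-order currents). [folklore] -/
theorem hardy_sum_fderiv_radialCurrent {y m : ℝ → ℝ} {y' m' r : ℝ} {ψ : E4 → ℝ} {x : E4}
    (hr : Kerr.radius 0 x = r) (h0 : 0 < r) (hy : HasDerivAt y y' r) (hm : HasDerivAt m m' r)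
    (hψ : DifferentiableAt ℝ ψ x) :
    fderiv ℝ (fun z ↦ 2⁻¹ * y (Kerr.radius 0 z) * ψ z ^ 2 * m (Kerr.radius 0 z)) x
        (E4.basisVector 0) +
      ∑ i : Fin 3, fderiv ℝ (fun z ↦ 2⁻¹ * y (Kerr.radius 0 z) * ψ z ^ 2 *
        ((1 - m (Kerr.radius 0 z)) * z i.succ / Kerr.radius 0 z)) x (E4.basisVector i.succ) =
    y r * ψ x * ((1 - m r) * (∑ i : Fin 3, x i.succ * fderiv ℝ ψ x (E4.basisVector i.succ)) / r +
        m r * fderiv ℝ ψ x (E4.basisVector 0)) +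
      2⁻¹ * ψ x ^ 2 * (r⁻¹ ^ 2 * deriv (fun s ↦ s ^ 2 * (1 - m s) * y s) r) := by
  -- one-dimensional calculus of the profiles
  have hK := (hy.const_mul 2⁻¹).fun_mul hm
  have hH := ((hy.const_mul 2⁻¹).fun_mul (hm.const_sub 1)).fun_div (hasDerivAt_id' r) h0.ne'
  have hpow : HasDerivAt (fun s : ℝ ↦ s ^ 2) (2 * r) r := by simpa using hasDerivAt_pow 2 r
  have hD := (hpow.fun_mul (hm.const_sub 1)).fun_mul hy
  -- the time component
  have hT : fderiv ℝ (fun z ↦ 2⁻¹ * y (Kerr.radius 0 z) * ψ z ^ 2 * m (Kerr.radius 0 z)) x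
      (E4.basisVector 0) = 2 * ψ x * fderiv ℝ ψ x (E4.basisVector 0) *
        (2⁻¹ * y r * m r) := by
    have hfun : (fun z ↦ 2⁻¹ * y (Kerr.radius 0 z) * ψ z ^ 2 * m (Kerr.radius 0 z)) =
        fun z ↦ ψ z ^ 2 * (2⁻¹ * y (Kerr.radius 0 z) * m (Kerr.radius 0 z)) := by
      funext z
      ring
    rw [hfun]
    exact hardy_fderiv_sq_mul_comp_radius_zero (K := fun s ↦ 2⁻¹ * y s * m s) hr h0 hK hψ
  -- the space components
  have hF : ∀ i : Fin 3, fderiv ℝ (fun z ↦ 2⁻¹ * y (Kerr.radius 0 z) * ψ z ^ 2 *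
      ((1 - m (Kerr.radius 0 z)) * z i.succ / Kerr.radius 0 z)) x (E4.basisVector i.succ) =
      2 * ψ x * fderiv ℝ ψ x (E4.basisVector i.succ) *
          (2⁻¹ * y r * (1 - m r) / r * x i.succ) +
        ψ x ^ 2 * fderiv ℝ (fun z ↦ 2⁻¹ * y (Kerr.radius 0 z) * (1 - m (Kerr.radius 0 z)) /
          Kerr.radius 0 z * z i.succ) x (E4.basisVector i.succ) := by
    intro i
    have hfun : (fun z ↦ 2⁻¹ * y (Kerr.radius 0 z) * ψ z ^ 2 *
        ((1 - m (Kerr.radius 0 z)) * z i.succ / Kerr.radius 0 z)) =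
        fun z ↦ ψ z ^ 2 * (2⁻¹ * y (Kerr.radius 0 z) * (1 - m (Kerr.radius 0 z)) /
          Kerr.radius 0 z * z i.succ) := by
      funext z
      ring
    rw [hfun]
    exact hardy_fderiv_sq_mul_comp_radius_mul_coord
      (H := fun s ↦ 2⁻¹ * y s * (1 - m s) / s) hr h0 hH hψ i
  have hDsum := hardy_sum_fderiv_comp_radius_mul_coord
    (g := fun s ↦ 2⁻¹ * y s * (1 - m s) / s) hr h0 hH
  rw [hT, hD.deriv, Finset.sum_congr rfl fun i _ ↦ hF i]
  simp only [Fin.sum_univ_three, Fin.succ_zero_eq_one, Fin.succ_one_eq_two,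
    Kerr.fin_succ_two_eq_three] at hDsum ⊢
  have hr0 : r ≠ 0 := h0.ne'
  linear_combination (norm := skip) ψ x ^ 2 * hDsum
  field_simp
  ring

/-! ### The registered stub -/

/-- **Stub `sum_fderiv_hardyCurrent_tailsCut`** (crux `AdiabaticMultiKerrILED`, line `Sketch`).
Divergence of the Hardy current `J_H^μ = ½ y(r) ψ² (∂_{r*})^μ` of the zero-spin tails-cut zone,
`(∂_{r*})⁰ = μ = χ(r) · 2H`, `(∂_{r*})ⁱ = (1 − μ) xⁱ/r`:
`∑_μ ∂_μ J_H^μ = y ψ ((1 − μ)(x⃗·∇ψ)/r + μ ∂₀ψ) + ½ ψ² r⁻² (r² f y)′(r)`, `f = 1 − χ · 2M/r`.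
Dafermos–Rodnianski arXiv:0811.0354, §4.1.1. [folklore] -/
theorem sum_fderiv_hardyCurrent_tailsCut : ∀ (M : ℝ) (y : ℝ → ℝ) (ψ : E4 → ℝ) (x : E4), 0 < M → 0 < Kerr.radius 0 x →
    DifferentiableAt ℝ y (Kerr.radius 0 x) → DifferentiableAt ℝ ψ x →
    ∑ μ, fderiv ℝ (fun z ↦ 2⁻¹ * y (Kerr.radius 0 z) * ψ z ^ 2 *
        (if μ = 0 then Real.smoothTransition (2 - Kerr.radius 0 z / (8 * M)) * (2 * Kerr.scalarH M 0 z)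
          else (1 - Real.smoothTransition (2 - Kerr.radius 0 z / (8 * M)) * (2 * Kerr.scalarH M 0 z)) * z μ / Kerr.radius 0 z))
        x (E4.basisVector μ) =
      y (Kerr.radius 0 x) * ψ x * ((1 - (Real.smoothTransition (2 - Kerr.radius 0 x / (8 * M)) * (2 * Kerr.scalarH M 0 x))) * (∑ i : Fin 3, x i.succ * fderiv ℝ ψ x (E4.basisVector i.succ)) / Kerr.radius 0 x + (Real.smoothTransition (2 - Kerr.radius 0 x / (8 * M)) * (2 * Kerr.scalarH M 0 x)) * fderiv ℝ ψ x (E4.basisVector 0)) +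
      2⁻¹ * ψ x ^ 2 * ((Kerr.radius 0 x)⁻¹ ^ 2 * deriv (fun s ↦ s ^ 2 * (fun s : ℝ ↦ 1 - Real.smoothTransition (2 - s / (8 * M)) * (2 * M / s)) s * y s) (Kerr.radius 0 x)) := by
  intro M y ψ x _ hx hy hψ
  -- the tails-cut profile as a function of `r` alone, and its differentiability at `r(x) > 0`
  have hS : ∀ u : ℝ, HasDerivAt Real.smoothTransition (deriv Real.smoothTransition u) u := fun u ↦
    ((Real.smoothTransition.contDiff (n := 1)).differentiable one_ne_zero u).hasDerivAt
  have hχ : HasDerivAt (fun s : ℝ ↦ Real.smoothTransition (2 - s / (8 * M)))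
      (deriv Real.smoothTransition (2 - Kerr.radius 0 x / (8 * M)) * -(1 / (8 * M)))
      (Kerr.radius 0 x) := by
    have h := (hS _).comp (Kerr.radius 0 x)
      (((hasDerivAt_id' (Kerr.radius 0 x)).div_const (8 * M)).const_sub 2)
    exact h
  have hm := hχ.fun_mul ((hasDerivAt_const (Kerr.radius 0 x) (2 * M)).fun_div
    (hasDerivAt_id' (Kerr.radius 0 x)) hx.ne')
  have hprof : ∀ z : E4,
      Real.smoothTransition (2 - Kerr.radius 0 z / (8 * M)) * (2 * Kerr.scalarH M 0 z) =
        Real.smoothTransition (2 - Kerr.radius 0 z / (8 * M)) * (2 * M / Kerr.radius 0 z) := by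
    intro z
    rw [hardy_scalarH_zero, mul_div_assoc]
  simp only [hprof]
  rw [Fin.sum_univ_succ]
  simp only [Fin.succ_ne_zero, ↓reduceIte]
  exact hardy_sum_fderiv_radialCurrent
    (m := fun s ↦ Real.smoothTransition (2 - s / (8 * M)) * (2 * M / s)) rfl hx hy.hasDerivAt
    hm hψ

end Summit.FinalStateConjecture.FinalStateConjecture.Theorems

end
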